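import Summits.BirchSwinnertonDyer.BirchSwinnertonDyer.Theorems.KolyvaginDepthDoorDepthTableSteinWuthrichRows9
import Summits.BirchSwinnertonDyer.BirchSwinnertonDyer.Theorems.KolyvaginDepthDoorDepthTableRowRankThree5077a1NoTwist
import Summits.BirchSwinnertonDyer.BirchSwinnertonDyer.Theorems.Rank2Observatory18745a1TwoDescRankThree
import HarnessLib

/-!
# Route `KolyvaginDepthDoor`, crux `KolyvaginDepthSupplyKN` (stmt-BirchSwinnertonDyer-22820) —
# DEPTH TABLE v14: the TENTH odd-rank row `18745a1` (rank `3`, `N = 5·23·163`) AT `p = 7`, RANK DISCHARGED —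
# `Ш(E)[7] = 0` BY NAME (Stein–Wuthrich 2013 Thm. 1.1), the depth-TWO bit ⟺ `#Sel_7(E^{(−11)}/ℚ) ≤ 49`, and the crux's
# clause at the curve modulo ONE bound on a twist of analytic rank ZERO (numerically)

Helper file of the lead prover of line `levelone` (kdd-p1 g18; `--supports stmt-BirchSwinnertonDyer-22820
--as helper`); it closes nothing and BSD is NOT proved by it.

Companion of `KolyvaginDepthDoorDepthTableSteinWuthrichRankThree{,<label>}` (nine rank-3 atlas curves at `p = 5`). The atlas
curve `18745a1 = [0,1,1,−146,636]` (`Δ = −5²·23²·163`, semistable) is MULTIPLICATIVE at `5`, hence absent from every `p = 5` row of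
the lineage; at `p = 7` everything is admissible and kernel-decidable, and it is (with `11642a1`) the odd-rank curve whose rank the
tree holds EXACTLY (`Rank2Observatory.C18745a1.mordellWeilRank_eq_three`, kernel 2-descent). New kernel certificates (`decide`
only): `mem_atlas`, `intModel`, `card_3`, `card_7`, `hasSurjectiveModNGaloisRep_pow_7` (semistable; `X² + 2X + 3` root-free mod `7`;
transvection from `163 ∥ Δ`), `not_hasCM`, `heegner_neg11`, `three_le_rank`, `mordellWeilRank_eq_three`, `goodOrdinary_7`,
`conductorNorm_eq`, `spade_7`, `kodairaNeron_7`. Then: `sha_inf_torsionBy_seven_eq_bot` (`Ш(E)[7] = 0` BY NAME, SW Thm. 1.1);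
`exactRowDepthTwo_7_neg11_iff_twistSelmer` («∃ `n₁` with EXACTLY TWO Kolyvagin primes, `c_1(n₁) ≠ 0`» `↔` «`#Sel_7(E^{(−11)}) ≤ 49`»);
`exactBody_7_neg11_iff_twistCondition` (the `∃`-body `↔` «`#Sel_7(E^{(−11)}) ≤ 7³` ∨ (`Ш(E^{(−11)})[7] = 0` ∧ `rank E^{(−11)} = 4`)»);
`cruxBody_of_twistSelmer` (the CLAUSE of the crux at `18745a1` VERBATIM from ONE bound `#Sel_7(E^{(−11)}/ℚ) ≤ 7³`).
The twist `E^{(−11)}` (conductor `2 268 145`) has EVEN analytic rank; numerically (context only) `L(E^{(−11)},1) ≈ 6.62 ≠ 0`, so the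
closing datum is the `7`-part of BSD of a RANK-ZERO curve (`CLOSING-DATA-v14.md`). CONDITIONAL on (γ) = Gross 1991 Prop. 3.7 (2)
(iff rows), W. Zhang 2014 Lemma 8.4 (1) / Thm. 9.1 and Stein–Wuthrich 2013 Thm. 1.1, BY NAME; per curve; nothing class-wide
(the open stub (S♭) is untouched); BSD is NOT proved by any of this.

References: [SteinWuthrich2013] Thm. 1.1 (p. 1758); [WZhang2014] Lemma 8.4 (1) (p. 236), Thm. 9.1 (p. 240), Hypothesis ♠;
[GrossLMS1991] Prop. 3.7 (2); [Serre1972] §5.4 Prop. 21; [CremonaAlgorithms1997] Table 1 (18745a1); [Silverman1994] IV.10.2.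
-/

set_option linter.dupNamespace false

noncomputable section

open scoped Classical NumberField

namespace Summit.BirchSwinnertonDyer.BirchSwinnertonDyer.Theorems.KolyvaginDepthDoor

open Literature.NumberTheory.EllipticCurves Literature.NumberTheory.EllipticCurves.ModularForms
  WeierstrassCurve NumberField IsDedekindDomain
open Summit.BirchSwinnertonDyer.BirchSwinnertonDyer.Theorems
open Summit.BirchSwinnertonDyer.BirchSwinnertonDyer.Rank2Observatory
open Summit.BirchSwinnertonDyer.BirchSwinnertonDyer.Rank1Residual
open Summit.BirchSwinnertonDyer.Rank1Residual.Additive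

namespace C18745a1

/-- `18745a1` is a curve of the kernel-certified rank-3 atlas `atlasR3A00`. [cite: CremonaAlgorithms1997, Table 1 (18745a1)] -/
theorem mem_atlas : c18745a1 ∈ atlasR3A00 := by simp [atlasR3A00]

/-- The integral model `[0,1,1,−146,636]` of `18745a1` is the tree's `integralModelInt` of the atlas curve `c18745a1.e ⊗ ℚ`
(globally minimal). [cite: CremonaAlgorithms1997, Table 1 (18745a1)] -/
theorem intModel :
    haveI := isElliptic_of_mem_atlasR3A00 mem_atlas;
    haveI := isGloballyMinimal_of_mem_atlasR3A00 mem_atlas;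
    integralModelInt (c18745a1.e.baseChange ℚ) = ⟨0, 1, 1, -146, 636⟩ := by
  haveI := isElliptic_of_mem_atlasR3A00 mem_atlas
  haveI := isGloballyMinimal_of_mem_atlasR3A00 mem_atlas
  exact IntModel.integralModelInt_eq_of_map_eq _ rfl

/-- `#Ẽ(𝔽₃)(18745a1) = 6`, i.e. `a_3 = −2` (kernel-decided). [cite: CremonaAlgorithms1997, Table 1 (18745a1)] -/
theorem card_3 :
    Nat.card (((⟨0, 1, 1, -146, 636⟩ : WeierstrassCurve ℤ).map (Int.castRingHom (ZMod 3))).toAffine.Point) = 6 := by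
  rw [PointCountNat.natCard_point_map_eq (hℓ := ⟨by norm_num⟩) (by norm_num) 0 1 1 (-146) 636
    (by decide +kernel)]
  decide +kernel

/-- `#Ẽ(𝔽₇)(18745a1) = 12`, i.e. `a_7 = −4` (kernel-decided). [cite: CremonaAlgorithms1997, Table 1 (18745a1)] -/
theorem card_7 :
    Nat.card (((⟨0, 1, 1, -146, 636⟩ : WeierstrassCurve ℤ).map (Int.castRingHom (ZMod 7))).toAffine.Point) = 12 := by
  rw [PointCountNat.natCard_point_map_eq (hℓ := ⟨by norm_num⟩) (by norm_num) 0 1 1 (-146) 636 (by decide +kernel)]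
  decide +kernel

/-- **`7 ∈ B(18745a1)`: `ρ̄_{E,7^m}` is onto for every `m`** (unconditional): semistable (`gcd(c₄, Δ) = 1`),
`X² − a_3 X + 3 = X² + 2X + 3` root-free mod `7` (`E[7]` irreducible, Mazur; onto, Serre Prop. 21), and the multiplicative prime
`163 ∥ Δ` with `7 ∤ 1` (a transvection lifts the image to `GL₂(ℤ/7^m)`). [cite: Serre1972, §5.4 Prop. 21]
[cite: SerreAbelianLadic1968, Ch. IV §3.4] -/
theorem hasSurjectiveModNGaloisRep_pow_7 (m : ℕ) :
    (c18745a1.e.baseChange ℚ).HasSurjectiveModNGaloisRep (7 ^ m : ℕ) := by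
  have hn : ∀ t : ZMod 7, t ^ 2 - (((3 : ℕ) : ℤ) + 1 - (6 : ℕ) : ℤ) * t + ((3 : ℕ) : ZMod 7) ≠ 0 := by
    decide +kernel
  haveI := isElliptic_of_mem_atlasR3A00 mem_atlas
  haveI := isGloballyMinimal_of_mem_atlasR3A00 mem_atlas
  haveI := Fact.mk (by norm_num : Nat.Prime 7)
  haveI := Fact.mk (by norm_num : Nat.Prime 3)
  exact hasSurjectiveModNGaloisRep_pow_of_intModel_certificate intModel
    (by rw [Int.isCoprime_iff_gcd_eq_one]; decide +kernel) 7 3 (by norm_num) (by decide +kernel)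
    (n := 6) card_3 hn 163 (by norm_num) (by norm_num) (by decide +kernel) (by decide +kernel)
    (e := 1) (by decide +kernel) (by decide +kernel) (by decide +kernel) m

/-- **`18745a1` is not CM** (unconditional): multiplicative reduction at `163` (`163 ∣ Δ`, `163 ∤ c₄ = 7024`), while a CM curve
over `ℚ` has no multiplicative prime. [cite: SilvermanATAEC1994, Thm. II.6.4 (PDF p. 148)] [cite: CremonaAlgorithms1997, Table 1 (18745a1)] -/
theorem not_hasCM :
    haveI := isElliptic_of_mem_atlasR3A00 mem_atlas;
    ¬ (c18745a1.e.baseChange ℚ).HasCM := by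
  haveI := isElliptic_of_mem_atlasR3A00 mem_atlas
  haveI := isGloballyMinimal_of_mem_atlasR3A00 mem_atlas
  haveI := Fact.mk (by norm_num : Nat.Prime 163)
  intro hCM
  exact not_hasMultiplicativeReductionAtPrime_of_hasCM _ hCM 163
    (IntModel.hasMultiplicativeReductionAtPrime_of_intModel intModel 163 (by decide +kernel)
      (by decide +kernel))

/-- **Heegner data `d_K = −11` for `18745a1`**: every prime of `Δ = −5²·23²·163` (hence of `N_E = 5·23·163`) splits in a
quadratic field of discriminant `−11` (`(−11/5) = (−11/23) = (−11/163) = 1`). [cite: Marcus1977, Ch. 3 Thm. 25] [cite: GrossLMS1991, §1] -/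
theorem heegner_neg11 : ∀ q : ℕ, q.Prime → (q : ℤ) ∣ (⟨0, 1, 1, -146, 636⟩ : WeierstrassCurve ℤ).Δ →
    (q = 2 → (-11 : ℤ) % 8 = 1) ∧ (q ≠ 2 → jacobiSym (-11) q = 1) := by
  intro q hq hqd
  have hΔ : (⟨0, 1, 1, -146, 636⟩ : WeierstrassCurve ℤ).Δ = -(5 ^ 2 * 23 ^ 2 * 163 : ℕ) := by decide +kernel
  rw [hΔ, Int.dvd_neg, Int.natCast_dvd_natCast] at hqd
  have h5 : Nat.Prime 5 := by norm_num
  have h23 : Nat.Prime 23 := by norm_num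
  have h163 : Nat.Prime 163 := by norm_num
  rcases (Nat.Prime.dvd_mul hq).mp hqd with h | h
  · rcases (Nat.Prime.dvd_mul hq).mp h with h' | h'
    · obtain rfl := (Nat.prime_dvd_prime_iff_eq hq h5).mp (hq.dvd_of_dvd_pow h')
      exact ⟨by norm_num, fun _ ↦ by norm_num⟩
    · obtain rfl := (Nat.prime_dvd_prime_iff_eq hq h23).mp (hq.dvd_of_dvd_pow h')
      exact ⟨by norm_num, fun _ ↦ by norm_num⟩
  · obtain rfl := (Nat.prime_dvd_prime_iff_eq hq h163).mp h
    exact ⟨by norm_num, fun _ ↦ by norm_num⟩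

/-- **`3 ≤ rank_ℤ E(ℚ)` for `18745a1 = c18745a1.e ⊗ ℚ`** (the tree's kernel census theorem `three_le_rank_of_mem_atlasR3A00`,
transported along `C.e ⊗ ℚ = C.row.curve`). [cite: CremonaAlgorithms1997, Table 1 (18745a1)] -/
theorem three_le_rank : 3 ≤ (c18745a1.e.baseChange ℚ).mordellWeilRank := by
  have hbc : c18745a1.e.baseChange ℚ = c18745a1.row.curve := by
    ext <;> simp [AtlasCurve3.e, Rank3Row.curve, WeierstrassCurve.baseChange]
  rw [hbc]
  exact three_le_rank_of_mem_atlasR3A00 mem_atlas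

/-- **`rank_ℤ E(ℚ) = 3` for the atlas curve `18745a1`** — the tree's kernel 2-descent
`Rank2Observatory.C18745a1.mordellWeilRank_eq_three`, transported along `c18745a1.e ⊗ ℚ = [0,1,1,−146,636] ⊗ ℚ` (`intModel`).
[cite: CremonaAlgorithms1997, §3.5, Table 1 (18745a1)] -/
theorem mordellWeilRank_eq_three :
    haveI := isElliptic_of_mem_atlasR3A00 mem_atlas;
    (c18745a1.e.baseChange ℚ).mordellWeilRank = 3 := by
  haveI := isElliptic_of_mem_atlasR3A00 mem_atlas
  haveI := isGloballyMinimal_of_mem_atlasR3A00 mem_atlas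
  have h : c18745a1.e.baseChange ℚ = (⟨0, 1, 1, -146, 636⟩ : WeierstrassCurve ℤ).baseChange ℚ :=
    eq_baseChange_of_intModel intModel
  have h' : (⟨0, 1, 1, -146, 636⟩ : WeierstrassCurve ℤ).baseChange ℚ = (⟨0, 1, 1, -146, 636⟩ : WeierstrassCurve ℤ).map (Int.castRingHom ℚ) := by
    rw [WeierstrassCurve.baseChange, algebraMap_int_eq]
  rw [h, h']
  exact Rank2Observatory.C18745a1.mordellWeilRank_eq_three

/-- **`7` is a prime of good ORDINARY reduction for `18745a1`** (`7 ∤ Δ`, `a_7 = −4 ≢ 0 (mod 7)`).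
[cite: CremonaAlgorithms1997, Table 1 (18745a1)] [cite: SilvermanAEC2009, VII.5 Prop. 5.1 (a)] -/
theorem goodOrdinary_7 :
    haveI := isGloballyMinimal_of_mem_atlasR3A00 mem_atlas;
    haveI := Fact.mk (by norm_num : Nat.Prime 7);
    (c18745a1.e.baseChange ℚ).HasGoodReductionAtPrime 7 ∧
      ¬ ((7 : ℕ) : ℤ) ∣ (c18745a1.e.baseChange ℚ).frobeniusTrace 7 := by
  haveI := isGloballyMinimal_of_mem_atlasR3A00 mem_atlas
  haveI := Fact.mk (by norm_num : Nat.Prime 7)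
  exact goodOrdinary_of_intModel_certificate intModel 7 (by decide +kernel) (n := 12) card_7 (by decide +kernel)

/-- **`N(18745a1) = 18745 = 5·23·163`** (semistable: `gcd(Δ, c₄) = 1`, `N = rad Δ`; Silverman ATAEC IV.10.2).
[cite: CremonaAlgorithms1997, Table 1 (18745a1)] [cite: Silverman1994, IV.10.2 (a),(b)] -/
theorem conductorNorm_eq :
    haveI := isElliptic_of_mem_atlasR3A00 mem_atlas;
    (c18745a1.e.baseChange ℚ).conductorNorm ℤ = 18745 := by
  haveI := isElliptic_of_mem_atlasR3A00 mem_atlas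
  haveI := isGloballyMinimal_of_mem_atlasR3A00 mem_atlas
  have h : c18745a1.e.baseChange ℚ = (⟨0, 1, 1, -146, 636⟩ : WeierstrassCurve ℤ).baseChange ℚ :=
    eq_baseChange_of_intModel intModel
  haveI : ((⟨0, 1, 1, -146, 636⟩ : WeierstrassCurve ℤ).baseChange ℚ).IsElliptic := by rw [← h]; infer_instance
  rw [h]
  refine BurungaleSkinner2023.conductorNorm_baseChange_int_of_isCoprime _
    (by rw [Int.isCoprime_iff_gcd_eq_one]; decide +kernel) (k := 2) ?_ (by decide +kernel) (by decide +kernel)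
  rw [Nat.squarefree_iff_nodup_primeFactorsList (by norm_num)]; simp

/-- **♠ (1) for `18745a1` at `p = 7`:** `|Δ_min| = 5²·23²·163` (exponents `2, 2, 1`, all prime to `7`) ⇒ `7 ∤ v_ℓ(Δ_min)` at
every multiplicative `ℓ`; `gcd(c₄, Δ) = 1` ⇒ semistable over `ℤ`. [cite: WZhang2014, Hypothesis ♠ (pp. 194–195)]
[cite: CremonaAlgorithms1997, Table 1 (18745a1)] -/
theorem spade_7 :
    haveI := isElliptic_of_mem_atlasR3A00 mem_atlas;
    haveI := isGloballyMinimal_of_mem_atlasR3A00 mem_atlas;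
    (∀ (ℓ : ℕ) [Fact ℓ.Prime], (c18745a1.e.baseChange ℚ).HasMultiplicativeReductionAtPrime ℓ →
      ¬ 7 ∣ padicValInt ℓ (c18745a1.e.baseChange ℚ).minimalDiscriminantInt) ∧
      (c18745a1.e.baseChange ℚ).IsSemistable ℤ := by
  haveI := isElliptic_of_mem_atlasR3A00 mem_atlas
  haveI := isGloballyMinimal_of_mem_atlasR3A00 mem_atlas
  haveI := Fact.mk (by norm_num : Nat.Prime 7)
  refine ⟨not_dvd_padicValInt_of_intModel intModel 7 ?_,
    isSemistable_int_of_intModel_of_isCoprime intModel (by rw [Int.isCoprime_iff_gcd_eq_one]; decide +kernel)⟩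
  intro q hq hqd
  have hΔ : (⟨0, 1, 1, -146, 636⟩ : WeierstrassCurve ℤ).Δ = -(5 ^ 2 * 23 ^ 2 * 163 : ℕ) := by decide +kernel
  have hqd' := hqd
  rw [hΔ, Int.dvd_neg, Int.natCast_dvd_natCast] at hqd'
  have h5 : Nat.Prime 5 := by norm_num
  have h23 : Nat.Prime 23 := by norm_num
  have h163 : Nat.Prime 163 := by norm_num
  rcases (Nat.Prime.dvd_mul hq).mp hqd' with h | h
  · rcases (Nat.Prime.dvd_mul hq).mp h with h' | h'
    · obtain rfl := (Nat.prime_dvd_prime_iff_eq hq h5).mp (hq.dvd_of_dvd_pow h')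
      exact ⟨2, by rw [hΔ]; decide +kernel, by rw [hΔ]; decide +kernel, by norm_num⟩
    · obtain rfl := (Nat.prime_dvd_prime_iff_eq hq h23).mp (hq.dvd_of_dvd_pow h')
      exact ⟨2, by rw [hΔ]; decide +kernel, by rw [hΔ]; decide +kernel, by norm_num⟩
  · obtain rfl := (Nat.prime_dvd_prime_iff_eq hq h163).mp h
    exact ⟨1, by rw [hΔ]; decide +kernel, by rw [hΔ]; decide +kernel, by norm_num⟩

/-- **Kodaira–Néron for `18745a1` at `p = 7`** (places form): `7 ∤ ord_v(Δ_min)` at every multiplicative `v` (exponents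
`2, 2, 1`; table lemma with `|Δ₀| < 9⁷`). [cite: SilvermanAEC2009, VII.5.1, VIII.8] [cite: CremonaAlgorithms1997, Table 1 (18745a1)] -/
theorem kodairaNeron_7 :
    haveI := isElliptic_of_mem_atlasR3A00 mem_atlas;
    haveI := isGloballyMinimal_of_mem_atlasR3A00 mem_atlas;
    ∀ v : HeightOneSpectrum (𝓞 ℚ), (c18745a1.e.baseChange ℚ).HasMultiplicativeReductionAt v →
      ¬ 7 ∣ (c18745a1.e.baseChange ℚ).ordMinimalDiscriminant v := by
  haveI := isElliptic_of_mem_atlasR3A00 mem_atlas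
  haveI := isGloballyMinimal_of_mem_atlasR3A00 mem_atlas
  exact not_dvd_ordMinimalDiscriminant_of_intModel_table intModel (p := 7) (Δ₀ := -2155675) (by decide +kernel)
    (B := 9) (by decide +kernel) (by decide +kernel)

/-- **`Ш(18745a1/ℚ)[7] = 0` BY NAME** — Stein–Wuthrich 2013 Thm. 1.1 at the kernel certificates: non-CM `not_hasCM`,
`2 ≤ 3 ≤ rank` `three_le_rank`, `N = 18745 ≤ 30 000` `conductorNorm_eq`, `7` good ordinary `goodOrdinary_7`, `ρ̄_{E,7}` onto
`hasSurjectiveModNGaloisRep_pow_7 1`. CONDITIONAL on that named fact; per curve; BSD is not proved by it.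
[cite: SteinWuthrich2013, Thm. 1.1 (p. 1758)] [cite: CremonaAlgorithms1997, Table 1 (18745a1)] -/
theorem sha_inf_torsionBy_seven_eq_bot (hSW : SteinWuthrich2013_sha_inf_torsionBy_eq_bot_of_two_le_rank) :
    haveI := isElliptic_of_mem_atlasR3A00 mem_atlas;
    haveI := Fact.mk (by norm_num : Nat.Prime 7);
    ((c18745a1.e.baseChange ℚ).sha ⊓ AddSubgroup.torsionBy (c18745a1.e.baseChange ℚ).galH1 ((7 : ℕ) : ℤ) :
      AddSubgroup _) = ⊥ := by
  haveI := isElliptic_of_mem_atlasR3A00 mem_atlas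
  haveI := isGloballyMinimal_of_mem_atlasR3A00 mem_atlas
  haveI := Fact.mk (by norm_num : Nat.Prime 7)
  have hsur : (c18745a1.e.baseChange ℚ).HasSurjectiveModNGaloisRep (7 ^ 1 : ℕ) := hasSurjectiveModNGaloisRep_pow_7 1
  rw [pow_one] at hsur
  exact hSW _ not_hasCM (le_trans (by norm_num) three_le_rank) (by rw [conductorNorm_eq]; norm_num) 7
    (by norm_num) (by norm_num) goodOrdinary_7.1 goodOrdinary_7.2 hsur

/-- **DEPTH-TABLE ROW `18745a1`, `(p, d_K) = (7, −11)`, at depth TWO, rank discharged — «ONE BIT ⟺ ONE TWIST-SELMER BOUND».**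
For `E = 18745a1` (`rank E(ℚ) = 3` in the kernel) and ANY imaginary quadratic `K` with `d_K = −11`: «∃ frame, square-free product
`n₁` of EXACTLY TWO Kolyvagin primes (for `p = 7`), datum: `c_1(n₁) ≠ 0 (mod 7)`» `↔` «`#Sel_7(E^{(−11)}/ℚ) ≤ 49`» — g14's
depth row on the ♠ cell (`kolyvaginClass_depth_ne_zero_iff_shaTrivial_twistSelmer_of_lemma84`) with `Ш(E)[7] = 0` DISCHARGED by
SW Thm. 1.1 and `rank E = 3` by the kernel 2-descent. The twist `E^{(−11)}` has EVEN analytic rank; where it is `0` (numerically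
`L(E^{(−11)},1) ≈ 6.62`) the bit is «`#Ш(E^{(−11)}/ℚ)[7] ≤ 49`». CONDITIONAL on (γ), W. Zhang L8.4 (1) / 9.1 and SW Thm. 1.1
by name; per curve; BSD is not proved by it. [cite: SteinWuthrich2013, Thm. 1.1 (p. 1758)] [cite: WZhang2014, Lemma 8.4 (1) (p. 236)]
[cite: GrossLMS1991, Prop. 3.7 (2), §5 (5.1)] [cite: JetchevLauterStein2009, §3.6 (arXiv:0707.0032)] -/
theorem exactRowDepthTwo_7_neg11_iff_twistSelmer
    (hSW : SteinWuthrich2013_sha_inf_torsionBy_eq_bot_of_two_le_rank)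
    (h372 : GrossLMS1991.prop37_2_frobeniusCongruence)
    (h84 : Literature.NumberTheory.EllipticCurves.WZhang2014_lemma84_exists_minimal_kolyvaginClass_one_selmerCard)
    (K : Type) [Field K] [NumberField K] (hK : IsImaginaryQuadratic K)
    (hD : NumberField.discr K = -11) :
    haveI := isElliptic_of_mem_atlasR3A00 mem_atlas;
    haveI := isGloballyMinimal_of_mem_atlasR3A00 mem_atlas;
    haveI : NeZero ((c18745a1.e.baseChange ℚ).conductorNorm ℤ) := neZero_conductorNorm_of_isElliptic _;
    haveI := Fact.mk (by norm_num : Nat.Prime 7);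
    (∃ (Dt : ModularParametrizationData (c18745a1.e.baseChange ℚ) ((c18745a1.e.baseChange ℚ).conductorNorm ℤ)) (β : ℤ) (ι : K →+* ℂ) (n₁ : ℕ)
      (d : KolyvaginHeegnerData Dt β ι n₁), Squarefree n₁ ∧
        (∀ q ∈ n₁.primeFactors, Zhang2014.IsKolyvaginPrime ((c18745a1.e.baseChange ℚ).conductorNorm ℤ) (c18745a1.e.baseChange ℚ) K 7 q) ∧
        n₁.primeFactors.card = 2 ∧ d.kolyvaginClass (p := 7) (by norm_num) 1 ≠ 0) ↔
    Nat.card (((c18745a1.e.baseChange ℚ).quadraticTwist (NumberField.discr K : ℚ)).selmerGroup (7 : ℕ)) ≤ 49 := by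
  haveI := isElliptic_of_mem_atlasR3A00 mem_atlas
  haveI := isGloballyMinimal_of_mem_atlasR3A00 mem_atlas
  haveI iNZ : NeZero ((c18745a1.e.baseChange ℚ).conductorNorm ℤ) := neZero_conductorNorm_of_isElliptic _
  haveI i7 := Fact.mk (by norm_num : Nat.Prime 7)
  have hsp := spade_7
  have hS2 : ¬ Squarefree ((c18745a1.e.baseChange ℚ).conductorNorm ℤ) →
      (∃ (ℓ : ℕ) (_ : Fact ℓ.Prime), (c18745a1.e.baseChange ℚ).HasMultiplicativeReductionAtPrime ℓ ∧
          ¬ 7 ∣ padicValInt ℓ (c18745a1.e.baseChange ℚ).minimalDiscriminantInt) ∧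
        ∃ (ℓ₁ ℓ₂ : ℕ) (_ : Fact ℓ₁.Prime) (_ : Fact ℓ₂.Prime), ℓ₁ ≠ ℓ₂ ∧
          (c18745a1.e.baseChange ℚ).HasMultiplicativeReductionAtPrime ℓ₁ ∧
            (c18745a1.e.baseChange ℚ).HasMultiplicativeReductionAtPrime ℓ₂ :=
    fun hns ↦ absurd ((c18745a1.e.baseChange ℚ).isSemistable_iff_squarefree_conductorNorm.mp hsp.2) hns
  have hH := satisfiesHeegnerHypothesis_conductorNorm_of_intModel intModel K hK.1 hD heegner_neg11
  have hD3 : NumberField.discr K ≠ -3 := by rw [hD]; norm_num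
  have hD4 : NumberField.discr K ≠ -4 := by rw [hD]; norm_num
  have hpD : ¬ (((7 : ℕ) : ℤ) ∣ NumberField.discr K) := by rw [hD]; norm_num
  have hr3 : 3 ≤ (c18745a1.e.baseChange ℚ).mordellWeilRank := three_le_rank
  have h := (kolyvaginClass_depth_ne_zero_iff_shaTrivial_twistSelmer_of_lemma84 h372 h84 _ not_hasCM 7 (by norm_num)
    goodOrdinary_7.1 goodOrdinary_7.2 hasSurjectiveModNGaloisRep_pow_7 kodairaNeron_7 hsp.1 hS2 K hK hD3 hD4 hpD hH
    (le_trans (by norm_num) hr3)).trans (and_iff_right (sha_inf_torsionBy_seven_eq_bot hSW))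
  rw [mordellWeilRank_eq_three] at h
  refine Iff.trans ?_ (h.trans (by norm_num))
  constructor
  · rintro ⟨Dt, β, ι, n₁, d, hsq, hk, hν, hne⟩
    exact ⟨Dt, β, ι, n₁, d, hsq, hk, by omega, hne⟩
  · rintro ⟨Dt, β, ι, n₁, d, hsq, hk, hν, hne⟩
    exact ⟨Dt, β, ι, n₁, d, hsq, hk, by omega, hne⟩

/-- **EXACT READING OF THE CRUX AT `18745a1`, `(7, −11)`, rank discharged.** For ANY imaginary quadratic `K` with `d_K = −11`:
the `∃`-body of `KolyvaginDepthSupplyKN` at `(E, 7, K)` (the crux's own wording) `↔` «`#Sel_7(E^{(−11)}/ℚ) ≤ 343` ∨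
(`Ш(E^{(−11)}/ℚ)[7] = 0` ∧ `rank E^{(−11)}(ℚ) = 4`)» — g14's exact reading on the ♠ cell with `Ш(E)[7] = 0` (SW) and `rank E = 3`
(kernel) substituted. At the rank-zero twist only the first disjunct can hold: the crux at this curve IS «`dim_𝔽₇ Sel_7(E^{(−11)}) ≤ 3`».
CONDITIONAL on (γ), W. Zhang L8.4 (1) / 9.1 and SW Thm. 1.1 by name; per curve; BSD is not proved by it.
[cite: SteinWuthrich2013, Thm. 1.1 (p. 1758)] [cite: WZhang2014, Lemma 8.4 (1) (p. 236), Thm. 9.1 (p. 240)] [cite: GrossLMS1991, Prop. 3.7 (2)] -/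
theorem exactBody_7_neg11_iff_twistCondition
    (hSW : SteinWuthrich2013_sha_inf_torsionBy_eq_bot_of_two_le_rank)
    (h372 : GrossLMS1991.prop37_2_frobeniusCongruence)
    (h84 : Literature.NumberTheory.EllipticCurves.WZhang2014_lemma84_exists_minimal_kolyvaginClass_one_selmerCard)
    (K : Type) [Field K] [NumberField K] (hK : IsImaginaryQuadratic K)
    (hD : NumberField.discr K = -11) :
    haveI := isElliptic_of_mem_atlasR3A00 mem_atlas;
    haveI := isGloballyMinimal_of_mem_atlasR3A00 mem_atlas;
    haveI : NeZero ((c18745a1.e.baseChange ℚ).conductorNorm ℤ) := neZero_conductorNorm_of_isElliptic _;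
    haveI := Fact.mk (by norm_num : Nat.Prime 7);
    (∃ (Dt : ModularParametrizationData (c18745a1.e.baseChange ℚ) ((c18745a1.e.baseChange ℚ).conductorNorm ℤ)) (β : ℤ) (ι : K →+* ℂ) (n₁ : ℕ)
      (d : KolyvaginHeegnerData Dt β ι n₁), Squarefree n₁ ∧
        (∀ q ∈ n₁.primeFactors, Zhang2014.IsKolyvaginPrime ((c18745a1.e.baseChange ℚ).conductorNorm ℤ) (c18745a1.e.baseChange ℚ) K 7 q) ∧
        d.kolyvaginClass (p := 7) (by norm_num) 1 ≠ 0 ∧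
        (n₁.primeFactors.card + 1 ≤ (c18745a1.e.baseChange ℚ).mordellWeilRank ∨
          (n₁.primeFactors.card ≤ (c18745a1.e.baseChange ℚ).mordellWeilRank ∧
            n₁.primeFactors.card + 1 ≤ ((c18745a1.e.baseChange ℚ).quadraticTwist (NumberField.discr K : ℚ)).mordellWeilRank))) ↔
    (Nat.card (((c18745a1.e.baseChange ℚ).quadraticTwist (NumberField.discr K : ℚ)).selmerGroup (7 : ℕ)) ≤ 343 ∨
      ((((c18745a1.e.baseChange ℚ).quadraticTwist (NumberField.discr K : ℚ)).sha ⊓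
          AddSubgroup.torsionBy ((c18745a1.e.baseChange ℚ).quadraticTwist (NumberField.discr K : ℚ)).galH1 ((7 : ℕ) : ℤ) :
          AddSubgroup ((c18745a1.e.baseChange ℚ).quadraticTwist (NumberField.discr K : ℚ)).galH1) = ⊥ ∧
        ((c18745a1.e.baseChange ℚ).quadraticTwist (NumberField.discr K : ℚ)).mordellWeilRank = 4)) := by
  haveI := isElliptic_of_mem_atlasR3A00 mem_atlas
  haveI := isGloballyMinimal_of_mem_atlasR3A00 mem_atlas
  haveI iNZ : NeZero ((c18745a1.e.baseChange ℚ).conductorNorm ℤ) := neZero_conductorNorm_of_isElliptic _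
  haveI i7 := Fact.mk (by norm_num : Nat.Prime 7)
  have hsp := spade_7
  have hS2 : ¬ Squarefree ((c18745a1.e.baseChange ℚ).conductorNorm ℤ) →
      (∃ (ℓ : ℕ) (_ : Fact ℓ.Prime), (c18745a1.e.baseChange ℚ).HasMultiplicativeReductionAtPrime ℓ ∧
          ¬ 7 ∣ padicValInt ℓ (c18745a1.e.baseChange ℚ).minimalDiscriminantInt) ∧
        ∃ (ℓ₁ ℓ₂ : ℕ) (_ : Fact ℓ₁.Prime) (_ : Fact ℓ₂.Prime), ℓ₁ ≠ ℓ₂ ∧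
          (c18745a1.e.baseChange ℚ).HasMultiplicativeReductionAtPrime ℓ₁ ∧
            (c18745a1.e.baseChange ℚ).HasMultiplicativeReductionAtPrime ℓ₂ :=
    fun hns ↦ absurd ((c18745a1.e.baseChange ℚ).isSemistable_iff_squarefree_conductorNorm.mp hsp.2) hns
  have hH := satisfiesHeegnerHypothesis_conductorNorm_of_intModel intModel K hK.1 hD heegner_neg11
  have hD3 : NumberField.discr K ≠ -3 := by rw [hD]; norm_num
  have hD4 : NumberField.discr K ≠ -4 := by rw [hD]; norm_num
  have hpD : ¬ (((7 : ℕ) : ℤ) ∣ NumberField.discr K) := by rw [hD]; norm_num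
  have hr3 : 3 ≤ (c18745a1.e.baseChange ℚ).mordellWeilRank := three_le_rank
  refine ((kolyvaginClass_rankClause_iff_shaTrivial_twistCondition_of_lemma84 h372 h84 _ not_hasCM 7 (by norm_num)
    goodOrdinary_7.1 goodOrdinary_7.2 hasSurjectiveModNGaloisRep_pow_7 kodairaNeron_7 hsp.1 hS2 K hK hD3 hD4 hpD hH).trans
    (and_iff_right (sha_inf_torsionBy_seven_eq_bot hSW))).trans ?_
  rw [mordellWeilRank_eq_three]
  norm_num

/-- **THE CRUX `KolyvaginDepthSupplyKN` AT THE RANK-THREE CURVE `18745a1`, MODULO ONE TWIST `7`-SELMER BOUND.** Granted the two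
named print facts (Stein–Wuthrich 2013 Thm. 1.1; W. Zhang 2014 Lemma 8.4 (1) / Thm. 9.1) and, for ONE imaginary quadratic `K` with
`d_K = −11`, the bound `#Sel_7(E^{(d_K)}/ℚ) ≤ 7³` on the Heegner twist, the CLAUSE of the crux holds at `W = 18745a1` VERBATIM:
witnesses `p = 7` (good ordinary, `ρ_{E,7^∞}` onto, Kodaira–Néron and ♠ from `|Δ(E₀)| = 5²·23²·163`), that `K` (Heegner `heegner_neg11`;
`7 ∤ 11`, `7` inert in `K`), W. Zhang's level-one class, first sign (`rank = 3`). The twist has EVEN analytic rank; numerically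
`L(E^{(−11)},1) ≈ 6.62 ≠ 0`, so the expected closing datum is `Sel_7(E^{(−11)}/ℚ) = 0` — a RANK-ZERO datum. CONDITIONAL on the two
named facts and the one twist datum; per curve (the open stub (S♭) is untouched); BSD is not proved by it.
[cite: SteinWuthrich2013, Thm. 1.1 (p. 1758)] [cite: WZhang2014, Lemma 8.4 (1) (p. 236), Thm. 9.1 (p. 240)] [cite: CremonaAlgorithms1997, Table 1 (18745a1)] -/
theorem cruxBody_of_twistSelmer
    (hSW : SteinWuthrich2013_sha_inf_torsionBy_eq_bot_of_two_le_rank)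
    (h84 : Literature.NumberTheory.EllipticCurves.WZhang2014_lemma84_exists_minimal_kolyvaginClass_one_selmerCard)
    (K : Type) [Field K] [NumberField K] (hK : IsImaginaryQuadratic K)
    (hD : NumberField.discr K = -11)
    (hT : haveI := isElliptic_of_mem_atlasR3A00 mem_atlas;
      Nat.card (((c18745a1.e.baseChange ℚ).quadraticTwist (NumberField.discr K : ℚ)).selmerGroup (7 : ℕ)) ≤ 7 ^ 3) :
    haveI := isElliptic_of_mem_atlasR3A00 mem_atlas;
    haveI := isGloballyMinimal_of_mem_atlasR3A00 mem_atlas;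
    ∃ (p : ℕ) (hp : Fact p.Prime), 5 ≤ p ∧ (c18745a1.e.baseChange ℚ).HasGoodReductionAtPrime p ∧
      ¬ (p : ℤ) ∣ (c18745a1.e.baseChange ℚ).frobeniusTrace p ∧
      (∀ n : ℕ, (c18745a1.e.baseChange ℚ).HasSurjectiveModNGaloisRep (p ^ n : ℕ)) ∧
      (∀ v : HeightOneSpectrum (𝓞 ℚ), (c18745a1.e.baseChange ℚ).HasMultiplicativeReductionAt v →
        ¬ p ∣ (c18745a1.e.baseChange ℚ).ordMinimalDiscriminant v) ∧
      ∃ (K : Type) (_ : Field K) (_ : NumberField K), IsImaginaryQuadratic K ∧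
        NumberField.discr K ≠ -3 ∧ NumberField.discr K ≠ -4 ∧
        ∃ (_ : NeZero ((c18745a1.e.baseChange ℚ).conductorNorm ℤ)),
          SatisfiesHeegnerHypothesis ((c18745a1.e.baseChange ℚ).conductorNorm ℤ) K ∧
        ∃ (Dt : ModularParametrizationData (c18745a1.e.baseChange ℚ) ((c18745a1.e.baseChange ℚ).conductorNorm ℤ))
          (β : ℤ) (ι : K →+* ℂ) (n₁ : ℕ) (d : KolyvaginHeegnerData Dt β ι n₁), Squarefree n₁ ∧
          (∀ q ∈ n₁.primeFactors,
            Zhang2014.IsKolyvaginPrime ((c18745a1.e.baseChange ℚ).conductorNorm ℤ) (c18745a1.e.baseChange ℚ) K p q) ∧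
          d.kolyvaginClass hp.out 1 ≠ 0 ∧
          (n₁.primeFactors.card + 1 ≤ (c18745a1.e.baseChange ℚ).mordellWeilRank ∨
            (n₁.primeFactors.card ≤ (c18745a1.e.baseChange ℚ).mordellWeilRank ∧
              n₁.primeFactors.card + 1 ≤
                ((c18745a1.e.baseChange ℚ).quadraticTwist (NumberField.discr K : ℚ)).mordellWeilRank)) := by
  haveI := isElliptic_of_mem_atlasR3A00 mem_atlas
  haveI := isGloballyMinimal_of_mem_atlasR3A00 mem_atlas
  haveI iNZ : NeZero ((c18745a1.e.baseChange ℚ).conductorNorm ℤ) := neZero_conductorNorm_of_isElliptic _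
  haveI i7 := Fact.mk (by norm_num : Nat.Prime 7)
  have hsp := spade_7
  have hS2 : ¬ Squarefree ((c18745a1.e.baseChange ℚ).conductorNorm ℤ) →
      (∃ (ℓ : ℕ) (_ : Fact ℓ.Prime), (c18745a1.e.baseChange ℚ).HasMultiplicativeReductionAtPrime ℓ ∧
          ¬ 7 ∣ padicValInt ℓ (c18745a1.e.baseChange ℚ).minimalDiscriminantInt) ∧
        ∃ (ℓ₁ ℓ₂ : ℕ) (_ : Fact ℓ₁.Prime) (_ : Fact ℓ₂.Prime), ℓ₁ ≠ ℓ₂ ∧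
          (c18745a1.e.baseChange ℚ).HasMultiplicativeReductionAtPrime ℓ₁ ∧
            (c18745a1.e.baseChange ℚ).HasMultiplicativeReductionAtPrime ℓ₂ :=
    fun hns ↦ absurd ((c18745a1.e.baseChange ℚ).isSemistable_iff_squarefree_conductorNorm.mp hsp.2) hns
  have hH := satisfiesHeegnerHypothesis_conductorNorm_of_intModel intModel K hK.1 hD heegner_neg11
  have hD3 : NumberField.discr K ≠ -3 := by rw [hD]; norm_num
  have hD4 : NumberField.discr K ≠ -4 := by rw [hD]; norm_num
  have hpD : ¬ (((7 : ℕ) : ℤ) ∣ NumberField.discr K) := by rw [hD]; norm_num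
  have hr3 : 3 ≤ (c18745a1.e.baseChange ℚ).mordellWeilRank := three_le_rank
  have hT' : Nat.card (((c18745a1.e.baseChange ℚ).quadraticTwist (NumberField.discr K : ℚ)).selmerGroup (7 : ℕ)) ≤
      7 ^ (c18745a1.e.baseChange ℚ).mordellWeilRank :=
    le_trans hT (Nat.pow_le_pow_right (by norm_num) hr3)
  exact cruxBody_of_twistSelmer_of_steinWuthrich hSW h84 _ not_hasCM (le_trans (by norm_num) hr3)
    (by rw [conductorNorm_eq]; norm_num) 7 (by norm_num) (by norm_num) goodOrdinary_7.1 goodOrdinary_7.2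
    hasSurjectiveModNGaloisRep_pow_7 kodairaNeron_7 hsp.1 hS2 K hK hD3 hD4 hpD hH hT'

end C18745a1

end Summit.BirchSwinnertonDyer.BirchSwinnertonDyer.Theorems.KolyvaginDepthDoor

end
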